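import Summits.ABC.ABC.Theorems.TowerFourSubLiouville.Negative.DialCalibration
import Summits.ABC.ABC.Theorems.TowerFourSubLiouville.Negative.Framing

/-!
# `TowerFourSubLiouville` (stmt-ABC-1649): the non-coprime dial is exactly `4/3` under `ABC`

Negative-side calibration lemma of the standing disprover (cycle 2, refuter-cdisprove-stmt-ABC-1649-g2-0),
sharpening `Negative.Framing.towerIneq4NoCoprime_of_abc` (`A > 5/3`) to the optimal `A ≥ 4/3`:
together with the unconditional floor `Negative.DialCalibration.towerIneq4NoCoprime_false_below_four_thirds`
(family `2^{4k} + 2^{4k} = 2·2^{4k}`), under `ABC` the level-4 tower inequality WITHOUT the coprimality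
hypothesis holds for exponent `A` if and only if `4/3 ≤ A` (`towerIneq4NoCoprime_iff_of_abc`).

Message for provers of the crux (`∃ A < 2`, coprime version): an argument that is insensitive to
`gcd(a,b) = 1` can prove at best `A = 4/3` — still `< 2`, so coprimality remains formally dispensable for the
crux as stated, but any target exponent below `4/3` must use it.

The proof is local (prime by prime).  KEY DIVISIBILITY (`cube_mul_radical_cube_dvd`): for a positive point with
`a ∣ X⁴`, `b ∣ Y⁴`, `c ∣ Z⁴` (`X = ∏ xᵢ`, … ; exponents `i+1 ≤ 4`) and ANY common factorisation `a = g a'`,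
`b = g b'`, `c = g c'`:  `g³ · rad(a'b'c')³ ∣ (XYZ)⁴`.  Indeed at a prime `p` with `m = v_p(g)`:
`v_p(a), v_p(b), v_p(c) ≥ m`, `v_p(a)+v_p(b)+v_p(c) = 3m + v_p(a'b'c')`, `v_p(a) ≤ 4 v_p(X)` etc., and integrality
gives `4 (v_p X + v_p Y + v_p Z) ≥ 3m + 3·[p ∣ a'b'c']` (the case `m ≡ 1, 2 mod 4` is where the ceilings bite).
Then `ABC` on the primitive triple (`c' < K·rad(a'b'c')^{1+e}`) gives `c³ = g³c'³ < K³ (g³R³) R^{3e} ≤ K³ Π^{4+3e}`,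
i.e. `c < K · Π^{4/3 + e}` (`noCoprime_core_of_abc`).
-/

namespace Summit.ABC.ABC.Theorems.TowerFourSubLiouville.Negative

open scoped BigOperators
open Summit.ABC.ABC.Theses.IneffectiveSubspace
open Literature.NumberTheory.DiophantineGeometry (IsABCTriple rad rad_def)

/-- The integer bookkeeping behind the key divisibility, one prime at a time: with `m = v_p(g)`,
`l = v_p(rad(a'b'c')) ≤ 1`, `(q, r, t) = (v_p a', v_p b', v_p c')` and `(α, β, γ) = (v_p X, v_p Y, v_p Z)`,
the hypotheses `m + q ≤ 4α`, `m + r ≤ 4β`, `m + t ≤ 4γ` and `l = 1 ⟹ q + r + t ≥ 1` force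
`3m + 3l ≤ 4(α + β + γ)` (the ceilings bite when `m ≡ 1, 2 (mod 4)`; split on `m mod 4`). -/
theorem valuation_arith {m l α β γ q r t : ℕ} (hl : l ≤ 1) (hr : 1 ≤ l → 1 ≤ q + r + t)
    (hA : m + q ≤ 4 * α) (hB : m + r ≤ 4 * β) (hC : m + t ≤ 4 * γ) :
    3 * m + 3 * l ≤ 4 * (α + β + γ) := by
  rcases Nat.lt_or_ge l 1 with h | h
  · omega
  · have h3 := hr h
    have hdm := Nat.div_add_mod m 4
    have hlt : m % 4 < 4 := Nat.mod_lt _ (by norm_num)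
    generalize m / 4 = k at hdm
    generalize m % 4 = j at hdm hlt
    subst hdm
    interval_cases j <;> omega

/-- **Key divisibility.** If `a ∣ X⁴`, `b ∣ Y⁴`, `c ∣ Z⁴` (all positive) and `a = g a'`, `b = g b'`, `c = g c'`
for some common factor `g`, then `g³ · rad(a'b'c')³ ∣ (XYZ)⁴`.  Prime by prime: with `m = v_p(g)`,
`4 v_p(X) ≥ m + v_p(a')`, `4 v_p(Y) ≥ m + v_p(b')`, `4 v_p(Z) ≥ m + v_p(c')`, `v_p(rad) ≤ 1`, and
`v_p(rad) = 1 ⟹ v_p(a') + v_p(b') + v_p(c') ≥ 1`; linear integer arithmetic (`omega`) does the rest. -/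
theorem cube_mul_radical_cube_dvd {a b c X Y Z g a' b' c' : ℕ}
    (hX : 0 < X) (hY : 0 < Y) (hZ : 0 < Z)
    (ha : a = g * a') (hb : b = g * b') (hc : c = g * c')
    (ha0 : 0 < a) (hb0 : 0 < b) (hc0 : 0 < c)
    (haX : a ∣ X ^ 4) (hbY : b ∣ Y ^ 4) (hcZ : c ∣ Z ^ 4) :
    g ^ 3 * (UniqueFactorizationMonoid.radical (a' * b' * c')) ^ 3 ∣ (X * Y * Z) ^ 4 := by
  have hg0 : g ≠ 0 := by rintro rfl; rw [zero_mul] at ha; omega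
  have ha'0 : a' ≠ 0 := by rintro rfl; rw [mul_zero] at ha; omega
  have hb'0 : b' ≠ 0 := by rintro rfl; rw [mul_zero] at hb; omega
  have hc'0 : c' ≠ 0 := by rintro rfl; rw [mul_zero] at hc; omega
  set R := UniqueFactorizationMonoid.radical (a' * b' * c') with hRdef
  have hR0 : R ≠ 0 := UniqueFactorizationMonoid.radical_ne_zero
  have hXYZ : X * Y * Z ≠ 0 := (Nat.mul_pos (Nat.mul_pos hX hY) hZ).ne'
  rw [← Nat.factorization_le_iff_dvd (mul_ne_zero (pow_ne_zero 3 hg0) (pow_ne_zero 3 hR0))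
    (pow_ne_zero 4 hXYZ), Finsupp.le_def]
  intro p
  have hL : (g ^ 3 * R ^ 3).factorization p = 3 * g.factorization p + 3 * R.factorization p := by
    rw [Nat.factorization_mul (pow_ne_zero 3 hg0) (pow_ne_zero 3 hR0), Nat.factorization_pow,
      Nat.factorization_pow]
    simp
  have hRHS : ((X * Y * Z) ^ 4).factorization p =
      4 * (X.factorization p + Y.factorization p + Z.factorization p) := by
    rw [Nat.factorization_pow, Nat.factorization_mul (Nat.mul_pos hX hY).ne' hZ.ne',
      Nat.factorization_mul hX.ne' hY.ne']
    simp
    ring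
  have hfa : a.factorization p = g.factorization p + a'.factorization p := by
    rw [ha, Nat.factorization_mul hg0 ha'0]; simp
  have hfb : b.factorization p = g.factorization p + b'.factorization p := by
    rw [hb, Nat.factorization_mul hg0 hb'0]; simp
  have hfc : c.factorization p = g.factorization p + c'.factorization p := by
    rw [hc, Nat.factorization_mul hg0 hc'0]; simp
  have hAX : a.factorization p ≤ 4 * X.factorization p := by
    have h := (Finsupp.le_def.mp
      ((Nat.factorization_le_iff_dvd ha0.ne' (pow_ne_zero 4 hX.ne')).mpr haX)) p
    simpa [Nat.factorization_pow] using h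
  have hBY : b.factorization p ≤ 4 * Y.factorization p := by
    have h := (Finsupp.le_def.mp
      ((Nat.factorization_le_iff_dvd hb0.ne' (pow_ne_zero 4 hY.ne')).mpr hbY)) p
    simpa [Nat.factorization_pow] using h
  have hCZ : c.factorization p ≤ 4 * Z.factorization p := by
    have h := (Finsupp.le_def.mp
      ((Nat.factorization_le_iff_dvd hc0.ne' (pow_ne_zero 4 hZ.ne')).mpr hcZ)) p
    simpa [Nat.factorization_pow] using h
  have hr1 : R.factorization p ≤ 1 :=
    Squarefree.natFactorization_le_one p UniqueFactorizationMonoid.squarefree_radical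
  have hr : 1 ≤ R.factorization p →
      1 ≤ a'.factorization p + b'.factorization p + c'.factorization p := by
    intro h1
    have hmem : p ∈ R.primeFactors := by
      rw [← Nat.support_factorization]
      exact Finsupp.mem_support_iff.mpr (by omega)
    rw [hRdef, Nat.primeFactors_radical] at hmem
    obtain ⟨hp, hdvd, hne⟩ := Nat.mem_primeFactors.mp hmem
    have hpos := hp.factorization_pos_of_dvd hne hdvd
    rw [Nat.factorization_mul (mul_ne_zero ha'0 hb'0) hc'0, Nat.factorization_mul ha'0 hb'0] at hpos
    simp only [Finsupp.coe_add, Pi.add_apply] at hpos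
    omega
  rw [hL, hRHS]
  rw [hfa] at hAX
  rw [hfb] at hBY
  rw [hfc] at hCZ
  exact valuation_arith hr1 hr hAX hBY hCZ

/-- **Core of the sharp non-coprime bound.** From abc with exponent `1 + e`: for ANY positive `a + b = c`
(not necessarily coprime) with `a ∣ X⁴`, `b ∣ Y⁴`, `c ∣ Z⁴` and `rad(abc) ∣ XYZ` one has
`c < K · (XYZ)^{4/3 + e}`: write `g = gcd(a,b)`, apply abc to the primitive triple and use
`cube_mul_radical_cube_dvd`: `c³ = g³c'³ < K³ (g³R³) R^{3e} ≤ K³ (XYZ)^{4+3e}`. -/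
theorem noCoprime_core_of_abc {K e : ℝ} (hK : 0 < K) (he : 0 < e)
    (hK' : ∀ a b c : ℕ, IsABCTriple a b c → (c : ℝ) < K * (rad a b c : ℝ) ^ (1 + e))
    {a b c X Y Z : ℕ} (ha : 0 < a) (hb : 0 < b) (hc : a + b = c)
    (hX : 0 < X) (hY : 0 < Y) (hZ : 0 < Z)
    (haX : a ∣ X ^ 4) (hbY : b ∣ Y ^ 4) (hcZ : c ∣ Z ^ 4) (hrad : rad a b c ∣ X * Y * Z) :
    (c : ℝ) < K * ((X * Y * Z : ℕ) : ℝ) ^ ((4 : ℝ) / 3 + e) := by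
  -- gcd decomposition `a = g a'`, `b = g b'`, `c = g c'`, `(a', b', c')` an abc triple
  set g := Nat.gcd a b with hg
  have hg0 : 0 < g := Nat.gcd_pos_of_pos_left _ ha
  obtain ⟨a', ha'⟩ : ∃ a', a = g * a' := Nat.gcd_dvd_left a b
  obtain ⟨b', hb'⟩ : ∃ b', b = g * b' := Nat.gcd_dvd_right a b
  have ha'0 : 0 < a' := by
    rcases Nat.eq_zero_or_pos a' with h0 | h0
    · rw [h0, mul_zero] at ha'; omega
    · exact h0
  have hb'0 : 0 < b' := by
    rcases Nat.eq_zero_or_pos b' with h0 | h0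
    · rw [h0, mul_zero] at hb'; omega
    · exact h0
  have hcop : Nat.Coprime a' b' := by
    have h1 : a' = a / g := by rw [ha', Nat.mul_div_cancel_left _ hg0]
    have h2 : b' = b / g := by rw [hb', Nat.mul_div_cancel_left _ hg0]
    rw [h1, h2]; exact Nat.coprime_div_gcd_div_gcd hg0
  set c' := a' + b' with hc'def
  have hcc' : c = g * c' := by rw [← hc, ha', hb', hc'def]; ring
  have hc0 : 0 < c := hc ▸ Nat.add_pos_left ha b
  have htriple : IsABCTriple a' b' c' := ⟨ha'0, hb'0, rfl, hcop⟩
  have hlt := hK' _ _ _ htriple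
  -- the two divisibilities
  have hD : g ^ 3 * (rad a' b' c') ^ 3 ∣ (X * Y * Z) ^ 4 := by
    rw [rad_def]
    exact cube_mul_radical_cube_dvd hX hY hZ ha' hb' hcc' ha hb hc0 haX hbY hcZ
  have hPpos : 0 < X * Y * Z := Nat.mul_pos (Nat.mul_pos hX hY) hZ
  have habc0 : a * b * c ≠ 0 := (Nat.mul_pos (Nat.mul_pos ha hb) hc0).ne'
  have hRdvd : rad a' b' c' ∣ X * Y * Z := by
    refine dvd_trans ?_ hrad
    rw [rad_def, rad_def]
    refine UniqueFactorizationMonoid.radical_dvd_radical ?_ habc0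
    exact mul_dvd_mul (mul_dvd_mul (Dvd.intro_left _ ha'.symm) (Dvd.intro_left _ hb'.symm))
      (Dvd.intro_left _ hcc'.symm)
  -- pass to ℝ
  set P : ℕ := X * Y * Z with hPdef
  set R : ℕ := rad a' b' c' with hRdef
  have hR0 : (0 : ℝ) < (R : ℝ) := by
    rw [hRdef, rad_def]; exact_mod_cast Nat.radical_pos _
  have hP0 : (0 : ℝ) < (P : ℝ) := by exact_mod_cast hPpos
  have hDR : (g : ℝ) ^ 3 * (R : ℝ) ^ 3 ≤ (P : ℝ) ^ 4 := by
    exact_mod_cast Nat.le_of_dvd (pow_pos hPpos 4) hD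
  have hRP : (R : ℝ) ≤ (P : ℝ) := by exact_mod_cast Nat.le_of_dvd hPpos hRdvd
  have hg0R : (0 : ℝ) < (g : ℝ) := by exact_mod_cast hg0
  have hc'0 : (0 : ℝ) ≤ (c' : ℝ) := by positivity
  have h1 : (c' : ℝ) ^ 3 < (K * (R : ℝ) ^ (1 + e)) ^ 3 := pow_lt_pow_left₀ hlt hc'0 (by norm_num)
  have h2 : (K * (R : ℝ) ^ (1 + e)) ^ 3 = K ^ 3 * (R : ℝ) ^ 3 * ((R : ℝ) ^ e) ^ 3 := by
    rw [Real.rpow_add hR0, Real.rpow_one]; ring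
  have h3 : ((R : ℝ) ^ e) ^ 3 ≤ ((P : ℝ) ^ e) ^ 3 :=
    pow_le_pow_left₀ (Real.rpow_nonneg hR0.le e) (Real.rpow_le_rpow hR0.le hRP he.le) 3
  have h5 : ((P : ℝ) ^ ((4 : ℝ) / 3)) ^ (3 : ℕ) = (P : ℝ) ^ (4 : ℕ) := by
    rw [← Real.rpow_natCast ((P : ℝ) ^ ((4 : ℝ) / 3)) 3, ← Real.rpow_mul hP0.le]
    norm_num
  have h4 : (K * (P : ℝ) ^ ((4 : ℝ) / 3 + e)) ^ 3 = K ^ 3 * (P : ℝ) ^ 4 * ((P : ℝ) ^ e) ^ 3 := by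
    rw [Real.rpow_add hP0, mul_pow, mul_pow, h5]; ring
  have hcube : (c : ℝ) ^ 3 < (K * (P : ℝ) ^ ((4 : ℝ) / 3 + e)) ^ 3 := by
    have hK3 : (0 : ℝ) ≤ K ^ 3 := by positivity
    have hRe : (0 : ℝ) ≤ ((R : ℝ) ^ e) ^ 3 := by positivity
    have hP4 : (0 : ℝ) ≤ (P : ℝ) ^ 4 := by positivity
    have hcR : (c : ℝ) = (g : ℝ) * (c' : ℝ) := by rw [hcc']; push_cast; ring
    calc (c : ℝ) ^ 3 = (g : ℝ) ^ 3 * (c' : ℝ) ^ 3 := by rw [hcR]; ring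
      _ < (g : ℝ) ^ 3 * (K * (R : ℝ) ^ (1 + e)) ^ 3 := mul_lt_mul_of_pos_left h1 (pow_pos hg0R 3)
      _ = K ^ 3 * ((g : ℝ) ^ 3 * (R : ℝ) ^ 3) * ((R : ℝ) ^ e) ^ 3 := by rw [h2]; ring
      _ ≤ K ^ 3 * (P : ℝ) ^ 4 * ((R : ℝ) ^ e) ^ 3 :=
          mul_le_mul_of_nonneg_right (mul_le_mul_of_nonneg_left hDR hK3) hRe
      _ ≤ K ^ 3 * (P : ℝ) ^ 4 * ((P : ℝ) ^ e) ^ 3 := mul_le_mul_of_nonneg_left h3 (mul_nonneg hK3 hP4)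
      _ = (K * (P : ℝ) ^ ((4 : ℝ) / 3 + e)) ^ 3 := h4.symm
  exact lt_of_pow_lt_pow_left₀ 3 (by positivity) hcube

/-- **Sharp non-coprime dial (conditional half).** `ABC ⟹ TowerIneq4NoCoprime A` for every `A ≥ 4/3`
(the level-4 tower inequality with the coprimality hypothesis dropped, inlined), improving
`towerIneq4NoCoprime_of_abc` (`A > 5/3`).  For a tower point, `a = ∏ xᵢ^{i+1} ∣ (∏ xᵢ)⁴` etc. and
`rad(abc) ∣ ∏ xᵢyᵢzᵢ` (`rad_dvd_towerProd`), so `noCoprime_core_of_abc` applies with `X = ∏ xᵢ`, `Y = ∏ yᵢ`,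
`Z = ∏ zᵢ`, `XYZ = Π`; finally `Π^{4/3+ε} ≤ Π^{A+ε}` as `Π ≥ 1`. -/
theorem towerIneq4NoCoprime_of_abc_sharp (habc : ABC) (A : ℝ) (hA : 4 / 3 ≤ A) :
    ∀ ε : ℝ, 0 < ε → ∃ C : ℝ, 0 < C ∧ ∀ x y z : Fin 4 → ℕ, (∀ i, 0 < x i ∧ 0 < y i ∧ 0 < z i) →
      (∏ i, x i ^ (i.val + 1)) + (∏ i, y i ^ (i.val + 1)) = ∏ i, z i ^ (i.val + 1) →
      ((∏ i, z i ^ (i.val + 1) : ℕ) : ℝ) < C * ((∏ i, x i * y i * z i : ℕ) : ℝ) ^ (A + ε) := by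
  intro ε hε
  obtain ⟨K, hK, hK'⟩ := (ABC_iff.mp habc) ε hε
  refine ⟨K, hK, fun x y z hpos heq => ?_⟩
  have ha0 : 0 < ∏ i, x i ^ (i.val + 1) := Finset.prod_pos fun i _ => pow_pos (hpos i).1 _
  have hb0 : 0 < ∏ i, y i ^ (i.val + 1) := Finset.prod_pos fun i _ => pow_pos (hpos i).2.1 _
  have hX0 : 0 < ∏ i, x i := Finset.prod_pos fun i _ => (hpos i).1
  have hY0 : 0 < ∏ i, y i := Finset.prod_pos fun i _ => (hpos i).2.1
  have hZ0 : 0 < ∏ i, z i := Finset.prod_pos fun i _ => (hpos i).2.2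
  have haX : (∏ i, x i ^ (i.val + 1)) ∣ (∏ i, x i) ^ 4 := by
    rw [← Finset.prod_pow]
    exact Finset.prod_dvd_prod_of_dvd _ _ fun i _ => pow_dvd_pow _ (by have := i.isLt; omega)
  have hbY : (∏ i, y i ^ (i.val + 1)) ∣ (∏ i, y i) ^ 4 := by
    rw [← Finset.prod_pow]
    exact Finset.prod_dvd_prod_of_dvd _ _ fun i _ => pow_dvd_pow _ (by have := i.isLt; omega)
  have hcZ : (∏ i, z i ^ (i.val + 1)) ∣ (∏ i, z i) ^ 4 := by
    rw [← Finset.prod_pow]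
    exact Finset.prod_dvd_prod_of_dvd _ _ fun i _ => pow_dvd_pow _ (by have := i.isLt; omega)
  have hPi : (∏ i, x i * y i * z i) = (∏ i, x i) * (∏ i, y i) * (∏ i, z i) := by
    rw [Finset.prod_mul_distrib, Finset.prod_mul_distrib]
  have hrad : rad (∏ i, x i ^ (i.val + 1)) (∏ i, y i ^ (i.val + 1)) (∏ i, z i ^ (i.val + 1)) ∣
      (∏ i, x i) * (∏ i, y i) * (∏ i, z i) := by
    rw [← hPi]; exact rad_dvd_towerProd x y z
  have hcore := noCoprime_core_of_abc hK hε hK' ha0 hb0 heq hX0 hY0 hZ0 haX hbY hcZ hrad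
  have hP1 : (1 : ℝ) ≤ (((∏ i, x i) * (∏ i, y i) * (∏ i, z i) : ℕ) : ℝ) := by
    exact_mod_cast Nat.mul_pos (Nat.mul_pos hX0 hY0) hZ0
  rw [hPi]
  calc ((∏ i, z i ^ (i.val + 1) : ℕ) : ℝ)
      < K * (((∏ i, x i) * (∏ i, y i) * (∏ i, z i) : ℕ) : ℝ) ^ ((4 : ℝ) / 3 + ε) := hcore
    _ ≤ K * (((∏ i, x i) * (∏ i, y i) * (∏ i, z i) : ℕ) : ℝ) ^ (A + ε) := by
        apply mul_le_mul_of_nonneg_left _ hK.le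
        exact Real.rpow_le_rpow_of_exponent_le hP1 (by linarith)

/-- **The non-coprime dial is exactly `4/3` under `ABC`.** Combining the sharp conditional upper half with the
unconditional floor `towerIneq4NoCoprime_false_below_four_thirds` (`2^{4k} + 2^{4k} = 2·2^{4k}`, `c ≍ Π^{4/3}`). -/
theorem towerIneq4NoCoprime_iff_of_abc (habc : ABC) (A : ℝ) :
    (∀ ε : ℝ, 0 < ε → ∃ C : ℝ, 0 < C ∧ ∀ x y z : Fin 4 → ℕ, (∀ i, 0 < x i ∧ 0 < y i ∧ 0 < z i) →
      (∏ i, x i ^ (i.val + 1)) + (∏ i, y i ^ (i.val + 1)) = ∏ i, z i ^ (i.val + 1) →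
      ((∏ i, z i ^ (i.val + 1) : ℕ) : ℝ) < C * ((∏ i, x i * y i * z i : ℕ) : ℝ) ^ (A + ε)) ↔ 4 / 3 ≤ A :=
  ⟨fun h => not_lt.mp fun hlt => towerIneq4NoCoprime_false_below_four_thirds A hlt h,
    towerIneq4NoCoprime_of_abc_sharp habc A⟩

end Summit.ABC.ABC.Theorems.TowerFourSubLiouville.Negative
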